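import Mathlib
import Summits.Ventures.PercRepro2.Defs
import Summits.Ventures.PercRepro2.Independence
import Summits.Ventures.PercRepro2.Harris
import Summits.Ventures.PercRepro2.Graph
import Summits.Ventures.PercRepro2.Events
import Summits.Ventures.PercRepro2.ZCLeafBuilt
import Summits.Ventures.PercRepro2.ZCInsertP

/-!
# (ZC) along any sequence of the four degree-two insertions — the kernel closure statement
(blind cell PercRepro2, mine-a g24; MINE-A.md §72.9)

A MIXED CHAIN is a list of records `(k, f₁, f₂, v, w, a₁, a₃, o)`: the KIND `k : Fin 4`
(`0` = Theorem E: `v = a₃` adjacent to `a₁`; `1` = Theorem F: `v = a₁` adjacent to `a₃`; `2` = Theorem G: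
`v = o` adjacent to `a₁`; `3` = Theorem H: `v = a₁` adjacent to `o`), the two edges `f₁` (to the other
mark) and `f₂ = vw`, and the MARKS `(a₁, a₃, o)` at that stage.  The marks move with the kind —
E: `(a₁, w, o)`, F: `(w, a₃, o)`, G: `(a₁, a₃, w)`, H: `(w, a₃, o)` — and the next record carries the
moved marks (`List.IsChain`).  **Theorem** (`zc_of_mixed_chain`): starting from the first record's
marks, if the weights with all record edges removed satisfy (ZC) for the final marks and EVERY up-set
(e.g. a forest), then (ZC) holds for `p` and the original marks and up-set.  The steps are the
`p`-forms of E, F, G, H (`ZCInsertP`); the degenerate case `{root} ∈ 𝓔` of the root kinds gives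
(ZC) `= 0`.  No definition; one seat.
-/

namespace Summit.Ventures.PercRepro2

section MixedChain

variable {V : Type*} {E : Type*} [Fintype E] [DecidableEq E] {R : Type*} [CommRing R]
  [LinearOrder R] [IsStrictOrderedRing R]

/-- **(ZC) along a mixed chain of the four degree-two insertions.**  A record is
`(k, f₁, f₂, v, w, a₁, a₃, o)` with the conventions of the module docstring. -/
theorem zc_of_mixed_chain {ends : E → Sym2 V} (L : List (Fin 4 × E × E × V × V × V × V × V))
    (hrec : ∀ r ∈ L, r.2.1 ≠ r.2.2.1 ∧ ends r.2.2.1 = s(r.2.2.2.1, r.2.2.2.2.1) ∧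
      ((r.1 = 0 ∧ r.2.2.2.1 = r.2.2.2.2.2.2.1 ∧ ends r.2.1 = s(r.2.2.2.1, r.2.2.2.2.2.1)
          ∧ r.2.2.2.1 ≠ r.2.2.2.2.2.1 ∧ r.2.2.2.1 ≠ r.2.2.2.2.2.2.2) ∨
       (r.1 = 1 ∧ r.2.2.2.1 = r.2.2.2.2.2.1 ∧ ends r.2.1 = s(r.2.2.2.1, r.2.2.2.2.2.2.1)
          ∧ r.2.2.2.1 ≠ r.2.2.2.2.2.2.1 ∧ r.2.2.2.1 ≠ r.2.2.2.2.2.2.2) ∨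
       (r.1 = 2 ∧ r.2.2.2.1 = r.2.2.2.2.2.2.2 ∧ ends r.2.1 = s(r.2.2.2.1, r.2.2.2.2.2.1)
          ∧ r.2.2.2.1 ≠ r.2.2.2.2.2.1 ∧ r.2.2.2.1 ≠ r.2.2.2.2.2.2.1) ∨
       (r.1 = 3 ∧ r.2.2.2.1 = r.2.2.2.2.2.1 ∧ ends r.2.1 = s(r.2.2.2.1, r.2.2.2.2.2.2.2)
          ∧ r.2.2.2.1 ≠ r.2.2.2.2.2.2.1 ∧ r.2.2.2.1 ≠ r.2.2.2.2.2.2.2)))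
    (hchain : List.IsChain (fun r r' => r'.2.2.2.2.2 =
      (if r.1 = 0 then (r.2.2.2.2.2.1, r.2.2.2.2.1, r.2.2.2.2.2.2.2)
       else if r.1 = 2 then (r.2.2.2.2.2.1, r.2.2.2.2.2.2.1, r.2.2.2.2.1)
       else (r.2.2.2.2.1, r.2.2.2.2.2.2.1, r.2.2.2.2.2.2.2))) L)
    (hpair : L.Pairwise (fun r r' => r.2.2.2.1 ∉ ends r'.2.1 ∧ r.2.2.2.1 ∉ ends r'.2.2.1)) :
    ∀ (p : E → R), IsProbVec p →
    (∀ r ∈ L, ∀ e, r.2.2.2.1 ∈ ends e → (∃ r' ∈ L, e = r'.2.1 ∨ e = r'.2.2.1) ∨ p e = 0) →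
    ∀ (m : V × V × V) (𝓔 : Set (Set V)), IsUpperSet 𝓔 → (∀ r, L.head? = some r → r.2.2.2.2.2 = m) →
    (∀ 𝓔' : Set (Set V), IsUpperSet 𝓔' →
      let p₀ := L.foldl (fun q r => Function.update (Function.update q r.2.1 0) r.2.2.1 0) p
      let m' := L.foldl (fun (_ : V × V × V) r =>
        if r.1 = 0 then (r.2.2.2.2.2.1, r.2.2.2.2.1, r.2.2.2.2.2.2.2)
        else if r.1 = 2 then (r.2.2.2.2.2.1, r.2.2.2.2.2.2.1, r.2.2.2.2.1)
        else (r.2.2.2.2.1, r.2.2.2.2.2.2.1, r.2.2.2.2.2.2.2)) m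
      let e := connEvent ends m'.1 m'.2.1
      let L' := connEvent ends m'.1 m'.2.2
      let U := clusterInEvent ends m'.1 𝓔'
      let γ := connEvent ends m'.2.1 m'.2.2
      0 ≤ prob p₀ (eᶜ ∩ L'ᶜ ∩ γᶜ) * (prob p₀ (U ∩ (e ∩ L')) - prob p₀ U * prob p₀ (e ∩ L'))
        - prob p₀ (eᶜ ∩ L'ᶜ ∩ γ) * (prob p₀ (U ∩ (e ∩ L'ᶜ)) - prob p₀ U * prob p₀ (e ∩ L'ᶜ))) →
    let e := connEvent ends m.1 m.2.1
    let L' := connEvent ends m.1 m.2.2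
    let U := clusterInEvent ends m.1 𝓔
    let γ := connEvent ends m.2.1 m.2.2
    0 ≤ prob p (eᶜ ∩ L'ᶜ ∩ γᶜ) * (prob p (U ∩ (e ∩ L')) - prob p U * prob p (e ∩ L'))
      - prob p (eᶜ ∩ L'ᶜ ∩ γ) * (prob p (U ∩ (e ∩ L'ᶜ)) - prob p U * prob p (e ∩ L'ᶜ)) := by
  induction L with
  | nil =>
    intro p _ _ m 𝓔 h𝓔 _ hbase
    have h := hbase 𝓔 h𝓔
    simpa using h
  | cons r L ih =>
    intro p hp hzero m 𝓔 h𝓔 hhead hbase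
    obtain ⟨k, f₁, f₂, v, w, a₁, a₃, o⟩ := r
    have hm : (a₁, a₃, o) = m := hhead (k, f₁, f₂, v, w, a₁, a₃, o) rfl
    subst hm
    obtain ⟨hf, hends₂, hkind⟩ := hrec (k, f₁, f₂, v, w, a₁, a₃, o) List.mem_cons_self
    simp only at hf hends₂ hkind
    have hrec' := fun r hr => hrec r (List.mem_cons_of_mem _ hr)
    have hchain' := hchain.tail
    have hpair' := (List.pairwise_cons.1 hpair).2
    have hhead' : ∀ r' ∈ L, v ∉ ends r'.2.1 ∧ v ∉ ends r'.2.2.1 := (List.pairwise_cons.1 hpair).1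
    have hmark : ∀ e, v ∈ ends e → e = f₁ ∨ e = f₂ ∨ p e = 0 := by
      intro e he
      rcases hzero (k, f₁, f₂, v, w, a₁, a₃, o) List.mem_cons_self e he with ⟨r', hr', h⟩ | h
      · rcases List.mem_cons.1 hr' with rfl | hr'
        · simp only at h
          rcases h with rfl | rfl
          · exact Or.inl rfl
          · exact Or.inr (Or.inl rfl)
        · exfalso
          rcases h with rfl | rfl
          · exact (hhead' r' hr').1 he
          · exact (hhead' r' hr').2 he
      · exact Or.inr (Or.inr h)
    -- the tail under `p[f₁, f₂ ↦ 0]`, for the moved marks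
    set p' := Function.update (Function.update p f₁ 0) f₂ 0 with hp'def
    have hp' : IsProbVec p' := (hp.update f₁ le_rfl zero_le_one).update f₂ le_rfl zero_le_one
    have hzero' : ∀ r ∈ L, ∀ e, r.2.2.2.1 ∈ ends e →
        (∃ r' ∈ L, e = r'.2.1 ∨ e = r'.2.2.1) ∨ p' e = 0 := by
      intro r hr e he
      rcases hzero r (List.mem_cons_of_mem _ hr) e he with ⟨r', hr', h⟩ | h
      · rcases List.mem_cons.1 hr' with rfl | hr'
        · right
          simp only at h
          rcases h with rfl | rfl
          · simp [hp'def, Function.update_of_ne hf]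
          · simp [hp'def]
        · exact Or.inl ⟨r', hr', h⟩
      · right
        by_cases h2 : e = f₂
        · subst h2; simp [hp'def]
        · by_cases h1 : e = f₁
          · subst h1; simp [hp'def, Function.update_of_ne h2]
          · rw [hp'def, Function.update_of_ne h2, Function.update_of_ne h1]; exact h
    -- the moved marks
    set m' : V × V × V := if k = 0 then (a₁, w, o) else if k = 2 then (a₁, a₃, w) else (w, a₃, o)
      with hm'def
    have hhead'' : ∀ r', L.head? = some r' → r'.2.2.2.2.2 = m' := by
      intro r' hr'
      exact (List.isChain_cons.1 hchain).1 r' hr'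
    have hbase' : ∀ 𝓔' : Set (Set V), IsUpperSet 𝓔' →
        let p₀ := L.foldl (fun q r => Function.update (Function.update q r.2.1 0) r.2.2.1 0) p'
        let m'' := L.foldl (fun (_ : V × V × V) r =>
          if r.1 = 0 then (r.2.2.2.2.2.1, r.2.2.2.2.1, r.2.2.2.2.2.2.2)
          else if r.1 = 2 then (r.2.2.2.2.2.1, r.2.2.2.2.2.2.1, r.2.2.2.2.1)
          else (r.2.2.2.2.1, r.2.2.2.2.2.2.1, r.2.2.2.2.2.2.2)) m'
        let e := connEvent ends m''.1 m''.2.1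
        let L' := connEvent ends m''.1 m''.2.2
        let U := clusterInEvent ends m''.1 𝓔'
        let γ := connEvent ends m''.2.1 m''.2.2
        0 ≤ prob p₀ (eᶜ ∩ L'ᶜ ∩ γᶜ) * (prob p₀ (U ∩ (e ∩ L')) - prob p₀ U * prob p₀ (e ∩ L'))
          - prob p₀ (eᶜ ∩ L'ᶜ ∩ γ) * (prob p₀ (U ∩ (e ∩ L'ᶜ)) - prob p₀ U * prob p₀ (e ∩ L'ᶜ)) := by
      intro 𝓔' h𝓔'
      have h := hbase 𝓔' h𝓔'
      simp only [List.foldl_cons] at h ⊢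
      exact h
    have hIH := ih hrec' hchain' hpair' p' hp' hzero' m' _ (isUpperSet_rootShift h𝓔 v) hhead'' hbase'
    simp only at hIH
    simp only
    -- the step, by kind
    rcases hkind with ⟨hk, hv, hends₁, hne₁, hne₂⟩ | ⟨hk, hv, hends₁, hne₁, hne₂⟩
      | ⟨hk, hv, hends₁, hne₁, hne₂⟩ | ⟨hk, hv, hends₁, hne₁, hne₂⟩
    · -- E
      subst hv
      simp only [hk, hm'def, if_true] at hIH
      exact zc_a3w_graph' hp hf hends₁ hends₂ hmark hne₁ hne₂ h𝓔 hIH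
    · -- F
      subst hv
      simp only [hk, hm'def, Fin.one_eq_zero_iff, if_false, show (1 : Fin 4) ≠ 2 by decide] at hIH
      by_cases h𝓔₁ : ({v} : Set V) ∈ 𝓔
      · have := zc_eq_zero_of_singleton_mem p ends v a₃ o h𝓔 h𝓔₁
        simp only at this
        rw [this]
      exact zc_rootw_graph' hp hf hends₁ hends₂ hmark hne₁ hne₂ h𝓔 h𝓔₁ hIH
    · -- G
      subst hv
      simp only [hk, hm'def, show (2 : Fin 4) ≠ 0 by decide, if_false, if_true] at hIH
      exact zc_ow_graph' hp hf hends₁ hends₂ hmark hne₁ hne₂ h𝓔 hIH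
    · -- H
      subst hv
      simp only [hk, hm'def, show (3 : Fin 4) ≠ 0 by decide, show (3 : Fin 4) ≠ 2 by decide, if_false] at hIH
      by_cases h𝓔₁ : ({v} : Set V) ∈ 𝓔
      · have := zc_eq_zero_of_singleton_mem p ends v a₃ o h𝓔 h𝓔₁
        simp only at this
        rw [this]
      exact zc_rootow_graph' hp hf hends₁ hends₂ hmark hne₁ hne₂ h𝓔 h𝓔₁ hIH

end MixedChain

end Summit.Ventures.PercRepro2
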